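import Mathlib.Data.Nat.Choose.Sum
import Mathlib.Algebra.Order.BigOperators.Group.Finset
import Mathlib.Algebra.BigOperators.Intervals
import Mathlib.Algebra.BigOperators.Field
import Mathlib.Algebra.Order.Field.Basic
import Mathlib.Data.Real.Basic
import Mathlib.Tactic.Positivity
import Mathlib.Tactic.Ring
import Mathlib.Tactic.Linarith
import Mathlib.Tactic.FieldSimp
import HarnessLib

/-!
# The hypergeometric family is stochastically increasing in the number of marked items

`X ~ H(M, L, m)` = number of marked items in a uniformly random `m`-subset of an `M`-set containing `L`
marked items, `P(X = l) = C(L, l) C(M − L, m − l) / C(M, m)`.  The family has monotone likelihood ratio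
in `l` with respect to the parameter `L` (E. L. Lehmann, J. P. Romano, *Testing Statistical Hypotheses*,
3rd ed., Springer 2005 [LehmannRomano2005], Example 3.4.1, there with `D` = number of defectives), hence
(Lemma 3.4.2 (i)/(ii) ibid.) `E_L ψ(X)` is non-decreasing in `L` for every non-decreasing `ψ`;
equivalently, for every non-increasing (antitone) `f`, `E_L f(X)` is non-increasing in `L`:
for `L ≤ L' ≤ M`, `Σ_{l ≤ m} f(l) P_{L'}(l) ≤ Σ_{l ≤ m} f(l) P_L(l)`.
[materialised text: Example 3.4.1 chunk p0078:L15–p0079:L3; Lemma 3.4.2 chunk p0083:L15–L22.]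

Proof typed here: an elementary one-step telescoping (not Lehmann's general MLR argument) — for
`L + 1 ≤ M` (write `N' = M − L − 1`) and `l ≤ m`,
`C(L+1,l) C(N',m−l) − C(L,l) C(N'+1,m−l) = D(l) − D(l+1)` with `D(l) = C(L,l−1) C(N',m−l)` for
`1 ≤ l ≤ m` and `D(0) = D(m+1) = 0`, by Pascal's rule on both factors; summation by parts then gives
`C(M,m) · Σ_{l≤m} f(l) (P_{L+1}(l) − P_L(l)) = Σ_{1≤l≤m} (f(l) − f(l−1)) D(l) ≤ 0` for antitone `f`;
induct from `L` to `L'`.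

`hypergeomPMFReal M L m l` below has the SAME BODY as
`Literature.Computability.QuantumComplexity.CertifiedRandomnessRestrictedAdversary.hypergeomPMF`
(Liu et al. 2025 accounting file; cell qa-cr), so statements transfer by unfolding; this general home
serves cell qa-cr line L-01 (`xeb-selection-ceiling`, rider stub `stub_hypergeom_stochMono`, whose
statement is `sum_mul_hypergeomPMFReal_antitone` up to that unfolding and an unused hypothesis `m ≤ M`).
Junk values: for `l > m` the weight is `C(L,l)·C(M−L,0) = C(L,l)` (truncated subtraction) — all sums
below run over `l ∈ {0,…,m}` only; for `m > M` the denominator `C(M,m) = 0` makes every weight `0`.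
No facts, no sorries.
-/

namespace Literature.Probability.Distributions

open Finset

/-- The hypergeometric probability mass function as a real number:
`P(X = l) = C(L,l) · C(M−L, m−l) / C(M,m)` for `X ~ H(M, L, m)` (Lehmann–Romano's `P_D(x)` with
`N = M`, `D = L`, `n = m`, `x = l`). [cite: LehmannRomano2005, Example 3.4.1] -/
noncomputable def hypergeomPMFReal (M L m l : ℕ) : ℝ :=
  ((Nat.choose L l : ℝ) * Nat.choose (M - L) (m - l)) / Nat.choose M m

/-- The hypergeometric weights are nonnegative. [cite: LehmannRomano2005, Example 3.4.1] -/
theorem hypergeomPMFReal_nonneg (M L m l : ℕ) : 0 ≤ hypergeomPMFReal M L m l := by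
  unfold hypergeomPMFReal
  positivity

/-- The telescoping potential `D(l) = C(L, l−1) · C(N', m−l)` for `1 ≤ l ≤ m`, and `D(l) = 0` for
`l = 0` or `l > m` (`N'` stands for `M − L − 1`; plumbing for the one-step identity). [folklore] -/
private def telesc (L N' m l : ℕ) : ℝ :=
  if l = 0 ∨ m < l then 0 else (Nat.choose L (l - 1) : ℝ) * Nat.choose N' (m - l)

/-- `D ≥ 0`. [folklore] -/
private theorem telesc_nonneg (L N' m l : ℕ) : 0 ≤ telesc L N' m l := by
  unfold telesc
  split_ifs
  · exact le_rfl
  · positivity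

/-- **One-step Pascal identity** (the likelihood-ratio step of Lehmann–Romano Example 3.4.1 in
additive form): for `l ≤ m`,
`C(L+1,l)·C(N',m−l) − C(L,l)·C(N'+1,m−l) = D(l) − D(l+1)`. [cite: LehmannRomano2005, Example 3.4.1] -/
private theorem one_step_identity (L N' m l : ℕ) (hl : l ≤ m) :
    (Nat.choose (L + 1) l : ℝ) * Nat.choose N' (m - l) - (Nat.choose L l : ℝ) * Nat.choose (N' + 1) (m - l)
      = telesc L N' m l - telesc L N' m (l + 1) := by
  rcases l with _ | k
  · -- l = 0
    rcases m with _ | j'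
    · simp [telesc]
    · have hD0 : telesc L N' (j' + 1) 0 = 0 := by simp [telesc]
      have hD1 : telesc L N' (j' + 1) (0 + 1) = (Nat.choose L 0 : ℝ) * Nat.choose N' j' := by
        rw [telesc, if_neg (by omega), show 0 + 1 - 1 = 0 from rfl,
          show j' + 1 - (0 + 1) = j' by omega]
      rw [hD0, hD1, Nat.sub_zero, Nat.choose_zero_right, Nat.choose_zero_right, Nat.choose_succ_succ]
      push_cast
      ring
  · -- l = k + 1
    obtain ⟨j, rfl⟩ : ∃ j, m = k + 1 + j := ⟨m - (k + 1), by omega⟩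
    rcases j with _ | j'
    · -- l = m
      have hD1 : telesc L N' (k + 1 + 0) (k + 1) = (Nat.choose L k : ℝ) * Nat.choose N' 0 := by
        rw [telesc, if_neg (by omega), show k + 1 - 1 = k from rfl,
          show k + 1 + 0 - (k + 1) = 0 by omega]
      have hD2 : telesc L N' (k + 1 + 0) (k + 1 + 1) = 0 := by
        rw [telesc, if_pos (by omega)]
      rw [hD1, hD2, show k + 1 + 0 - (k + 1) = 0 by omega, Nat.choose_zero_right, Nat.choose_zero_right,
        Nat.choose_succ_succ]
      push_cast
      ring
    · -- l < m
      have hD1 : telesc L N' (k + 1 + (j' + 1)) (k + 1) =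
          (Nat.choose L k : ℝ) * Nat.choose N' (j' + 1) := by
        rw [telesc, if_neg (by omega), show k + 1 - 1 = k from rfl,
          show k + 1 + (j' + 1) - (k + 1) = j' + 1 by omega]
      have hD2 : telesc L N' (k + 1 + (j' + 1)) (k + 1 + 1) =
          (Nat.choose L (k + 1) : ℝ) * Nat.choose N' j' := by
        rw [telesc, if_neg (by omega), show k + 1 + 1 - 1 = k + 1 from rfl,
          show k + 1 + (j' + 1) - (k + 1 + 1) = j' by omega]
      rw [hD1, hD2, show k + 1 + (j' + 1) - (k + 1) = j' + 1 by omega, Nat.choose_succ_succ,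
        Nat.choose_succ_succ N' j']
      push_cast
      ring

/-- **One step** `L → L + 1` of the stochastic monotonicity, numerator form: for antitone `f`,
`Σ_{l ≤ m} f(l) C(L+1,l) C(N',m−l) ≤ Σ_{l ≤ m} f(l) C(L,l) C(N'+1,m−l)` (summation by parts against the
nonnegative potential `D`). [cite: LehmannRomano2005, Lemma 3.4.2 (i) with Example 3.4.1] -/
private theorem sum_one_step_le (L N' m : ℕ) {f : ℕ → ℝ} (hf : Antitone f) :
    ∑ l ∈ range (m + 1), f l * ((Nat.choose (L + 1) l : ℝ) * Nat.choose N' (m - l))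
      ≤ ∑ l ∈ range (m + 1), f l * ((Nat.choose L l : ℝ) * Nat.choose (N' + 1) (m - l)) := by
  rw [← sub_nonpos, ← Finset.sum_sub_distrib]
  have hrw : ∀ l ∈ range (m + 1),
      f l * ((Nat.choose (L + 1) l : ℝ) * Nat.choose N' (m - l))
        - f l * ((Nat.choose L l : ℝ) * Nat.choose (N' + 1) (m - l))
      = f l * telesc L N' m l - f l * telesc L N' m (l + 1) := by
    intro l hl
    rw [← mul_sub, one_step_identity L N' m l (by simpa [Nat.lt_succ_iff] using hl), mul_sub]
  rw [Finset.sum_congr rfl hrw, Finset.sum_sub_distrib]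
  -- shift the first sum: `Σ_{l<m+1} f l D l = f 0 D 0 + Σ_{l<m} f(l+1) D(l+1)`, with `D 0 = 0`;
  -- split the second: `Σ_{l<m+1} f l D(l+1) = Σ_{l<m} f l D(l+1) + f m D(m+1)`, with `D(m+1) = 0`.
  rw [Finset.sum_range_succ' (fun l => f l * telesc L N' m l), Finset.sum_range_succ]
  have h0 : telesc L N' m 0 = 0 := by simp [telesc]
  have hm : telesc L N' m (m + 1) = 0 := by
    simp only [telesc]
    rw [if_pos (Or.inr (Nat.lt_succ_self m))]
  rw [h0, hm, mul_zero, mul_zero, add_zero, add_zero, ← Finset.sum_sub_distrib]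
  refine Finset.sum_nonpos fun l _ => ?_
  rw [← sub_mul]
  exact mul_nonpos_of_nonpos_of_nonneg (sub_nonpos.mpr (hf (Nat.le_succ l))) (telesc_nonneg _ _ _ _)

/-- **One step** `L → L + 1` for the hypergeometric law itself: for antitone `f` and `L + 1 ≤ M`,
`Σ_{l ≤ m} f(l) P_{L+1}(l) ≤ Σ_{l ≤ m} f(l) P_L(l)`. [cite: LehmannRomano2005, Lemma 3.4.2 (i) with Example 3.4.1] -/
theorem sum_mul_hypergeomPMFReal_succ_le (M L m : ℕ) (hL : L + 1 ≤ M) {f : ℕ → ℝ} (hf : Antitone f) :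
    ∑ l ∈ range (m + 1), f l * hypergeomPMFReal M (L + 1) m l
      ≤ ∑ l ∈ range (m + 1), f l * hypergeomPMFReal M L m l := by
  obtain ⟨N', hN'⟩ : ∃ N', M = L + 1 + N' := ⟨M - (L + 1), by omega⟩
  have e1 : M - (L + 1) = N' := by omega
  have e2 : M - L = N' + 1 := by omega
  unfold hypergeomPMFReal
  rw [e1, e2]
  simp_rw [mul_div_assoc', ← Finset.sum_div]
  exact div_le_div_of_nonneg_right (sum_one_step_le L N' m hf) (Nat.cast_nonneg _)

/-- **Hypergeometric stochastic monotonicity in the number of marked items** (Lehmann–Romano 2005,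
Example 3.4.1 + Lemma 3.4.2): for `L ≤ L' ≤ M` and every antitone `f : ℕ → ℝ`,
`Σ_{l=0}^{m} f(l) · P_{H(M,L',m)}(l) ≤ Σ_{l=0}^{m} f(l) · P_{H(M,L,m)}(l)` — the expectation of a
non-increasing function does not increase when marked items are added (equivalently `H(M,L,m) ≤_st
H(M,L',m)`). [cite: LehmannRomano2005, Lemma 3.4.2 (i)–(ii) with Example 3.4.1] -/
theorem sum_mul_hypergeomPMFReal_antitone (M m L L' : ℕ) {f : ℕ → ℝ} (hf : Antitone f)
    (hLL' : L ≤ L') (hL'M : L' ≤ M) :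
    ∑ l ∈ range (m + 1), f l * hypergeomPMFReal M L' m l
      ≤ ∑ l ∈ range (m + 1), f l * hypergeomPMFReal M L m l := by
  induction L', hLL' using Nat.le_induction with
  | base => exact le_rfl
  | succ L' hLL' ih =>
      exact (sum_mul_hypergeomPMFReal_succ_le M L' m hL'M hf).trans (ih (Nat.le_of_succ_le hL'M))

/-- The same statement in the argument order of cell qa-cr's rider stub (`M, m, L, L', f`, hypotheses
`Antitone f → m ≤ M → L ≤ L' → L' ≤ M`; the hypothesis `m ≤ M` is not needed).
[cite: LehmannRomano2005, Lemma 3.4.2 (i)–(ii) with Example 3.4.1] -/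
theorem hypergeom_stochMono (M m L L' : ℕ) (f : ℕ → ℝ) (hf : Antitone f) (_hm : m ≤ M)
    (hLL' : L ≤ L') (hL'M : L' ≤ M) :
    ∑ l ∈ range (m + 1), f l * hypergeomPMFReal M L' m l
      ≤ ∑ l ∈ range (m + 1), f l * hypergeomPMFReal M L m l :=
  sum_mul_hypergeomPMFReal_antitone M m L L' hf hLL' hL'M

end Literature.Probability.Distributions
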